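import Mathlib
import HarnessLib
import Summits.HubbardSuperconductivity.HubbardSuperconductivity.Theorems.KLProgrammeKLRegimeSplitTwoLegReductions
import Summits.HubbardSuperconductivity.HubbardSuperconductivity.Theorems.KLProgrammeKLRegimeSplitEvalDerivBounds
import Summits.HubbardSuperconductivity.HubbardSuperconductivity.Theorems.KLProgrammeKLRegimeSplitFrameFn
import Summits.HubbardSuperconductivity.HubbardSuperconductivity.Theorems.KLProgrammeKLRegimeEngineV8DefsG2
import Summits.HubbardSuperconductivity.HubbardSuperconductivity.Theorems.KLProgrammeKLRegimeEngineV8DefsQ3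

/-!
# Route `KLProgramme` — ENGINE child 19855 (and its gen-5 twin), two-leg stubs on the DE-INTERPOLATED carrier (Δ23): the token ports of
# p1b's generic reductions — (E3b-Fn) the FLOOR from the (E3a-Fn) order-2 SIZE, and (E3g-Fn) the ANGULAR regularity of `klLocalPartFn` from
# momentum regularity of the two-leg interpolant (kernel MOMENTS) and the Fermi-point map `klFermiPointFn`

Cell `gate-hubbard-kl`, seat p1b (g6).  `…SplitTwoLegReductions` (p468454) and `…TwoLegAngularOfMoments` (p473408) proved these for the `TrigPolyC4v` /
`klFrameExtG` carrier (`TwoLegSizesG`, `TwoLegFloorG`, `TwoLegAngularG`, `klLocalPart`).  The gen-5 slot texts are p2's `TwoLegSizesFn` / `TwoLegFloorFn` /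
`TwoLegAngularFn` over function pieces `klTwoLegPieceFn` and the local part `klLocalPartFn … K n θ = S_n.eval (klFermiPointFn μ K θ)`,
`S_n = symInterp L (klLocSelfEnergyRe … (toTrigPoly L K) n)` (`…SplitFrameFn` §4; identical under (R-I) and (R-I-min)).  The proofs are
carrier-blind, so this is a token port:

* §1 `twoLegFloorFn_of_sizes`: `TwoLegSizesFn … n ∧ twoLegBar 2 n ≤ bflBar n ⇒ TwoLegFloorFn … n` (`|hessQuad| ≤ ‖D²ℓ_n‖·‖t‖²`); at `n = 0` for
  constants with `S 2 ≤ Bf`, `S′ 2 ≤ Bf` — in particular at the registered package `klEngGeo3` / `klEngQ3 P R` (`twoLegFloorFn_zero_of_sizes_klEng3`);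
* §2 `klLocalPartFn_eq_comp` (the local part is `evalM S_n ∘ (toLp ∘ klFermiPointFn μ K)`), `abs_iteratedDeriv_klLocalPartFn_le`
  (`|∂_θ^m ν_n| ≤ m!·C·D^m` from `‖Dⁱ evalM S_n‖ ≤ C` and a `C^m` Fermi-point map with `‖Dⁱγ‖ ≤ Dⁱ`), `norm_iteratedFDeriv_evalM_symInterp_le_of_moments`
  (`‖Dʲ evalM (symInterp L f)‖ ≤` the `j`-th coefficient moment — any lattice data `f`), and the closers `twoLegAngularFn_of_curve_bounds` /
  **`twoLegAngularFn_of_moments_and_curve`**: (E3g-Fn) from the moments of orders `≤ 4` of the scale-`n` two-leg coefficients + a `C⁴` Fermi-point map +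
  the fit `j!·m·Dʲ ≤ angBar … j`.

The `C⁴` bounds of `θ ↦ toLp (klFermiPointFn μ K θ)` for admissible function frames (the `FrameOKFn` twin of `fermiPointLp_C4_of_frameOK`) are the
curve-side input, not reproved here.  Proofs only; nothing about the model is asserted.  References: BGM 2006 (2.36), §2.4 Lemma 2.1
[cite: BenfattoGiulianiMastropietro2006].
-/

noncomputable section

namespace Summit.HubbardSuperconductivity.HubbardSuperconductivity.Theorems.KLRegimeSplit

set_option linter.dupNamespace false -- summit = problem name (single-conjunct summit), D-0017

open scoped InnerProductSpace
open Real Finset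
open Literature.MathematicalPhysics.QuantumLattice Literature.Probability.LatticeModels
open Literature.MathematicalPhysics.QuantumLattice.FermiRG
open Summit.HubbardSuperconductivity.HubbardSuperconductivity.Theorems.KLProgrammeLegKernels
open Summit.HubbardSuperconductivity.HubbardSuperconductivity.Theorems.DispersionFlow
open Summit.HubbardSuperconductivity.HubbardSuperconductivity.Theorems.PerturbedFermiCurve
open Summit.HubbardSuperconductivity.HubbardSuperconductivity.Theorems.EngineV8

/-! ## §1 (E3b-Fn) the floor from the (E3a-Fn) order-2 size -/

section Model

variable {L M : ℕ} [NeZero L] [NeZero M]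

/-- **(E3a-Fn) order 2 ⇒ (E3b-Fn)** whenever `twoLegBar G Q U 2 n ≤ bflBar G Q U n`: the floor `−bflBar·‖t‖²` is implied by
`|hessQuad| ≤ ‖D²ℓ_n‖·‖t‖²` (no tangency or tube condition is used). -/
theorem twoLegFloorFn_of_sizes {G : GeoConsts} {Q : EngConsts} {R : RenConsts} {β U μ : ℝ} {K : FrameFn} {n : ℕ}
    (hsz : TwoLegSizesFn L M G Q R β U μ K n) (hle : twoLegBar G Q U 2 n ≤ bflBar G Q U n) :
    TwoLegFloorFn L M G Q β U μ K n := by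
  intro p _ t _
  have h2 := hsz.2.1 2 le_rfl p
  have hq := neg_norm_iteratedFDeriv_two_mul_le_hessQuad (onM (klTwoLegPieceFn L M β U μ K n)) p t
  have ht : 0 ≤ ‖t‖ ^ 2 := sq_nonneg _
  nlinarith [mul_le_mul_of_nonneg_right (h2.trans hle) ht]

/-- **(E3a-Fn)₀ ⇒ (E3b-Fn)₀** for constants with `G.S 2 ≤ G.Bf`, `Q.S' 2 ≤ Q.Bf`. -/
theorem twoLegFloorFn_zero_of_sizes {G : GeoConsts} {Q : EngConsts} {R : RenConsts} (hS : G.S 2 ≤ G.Bf) (hS' : Q.S' 2 ≤ Q.Bf)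
    {β U μ : ℝ} {K : FrameFn} (hsz : TwoLegSizesFn L M G Q R β U μ K 0) : TwoLegFloorFn L M G Q β U μ K 0 :=
  twoLegFloorFn_of_sizes hsz (twoLegBar_two_zero_le_bflBar_zero hS hS' U)

/-- **(E3a-Fn)₀ ⇒ (E3b-Fn)₀ AT THE REGISTERED PACKAGE** `klEngGeo3` / `klEngQ3 P R` of the 19855 skeleton (`S 2 = Bf`, `S' 2 = Bf` there): the
floor clause of `stub_twoLeg_scale0` follows from its size clause. -/
theorem twoLegFloorFn_zero_of_sizes_klEng3 (P : SplitConsts) (R : RenConsts) {β U μ : ℝ} {K : FrameFn}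
    (hsz : TwoLegSizesFn L M klEngGeo3 (klEngQ3 P R) R β U μ K 0) : TwoLegFloorFn L M klEngGeo3 (klEngQ3 P R) β U μ K 0 :=
  twoLegFloorFn_zero_of_sizes (le_of_eq rfl) (le_of_eq rfl) hsz

end Model

/-! ## §2 (E3g-Fn) angular regularity from momentum regularity and the curve -/

section Model

variable (L M : ℕ) [NeZero L] [NeZero M]

/-- **The local part is the two-leg interpolant read along the Fermi-point map**:
`ν_n(K) = evalM S_n ∘ (θ ↦ toLp 2 (klFermiPointFn μ K θ))`, `S_n = symInterp L (klLocSelfEnergyRe … (toTrigPoly L K) n)`. -/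
theorem klLocalPartFn_eq_comp (β U μ : ℝ) (K : FrameFn) (n : ℕ) :
    klLocalPartFn L M β U μ K n =
      evalM (symInterp L (klLocSelfEnergyRe L M β U μ (toTrigPoly L K) n)) ∘
        fun θ => (WithLp.toLp 2 (klFermiPointFn μ K θ) : Momentum) := by
  funext θ
  rfl

variable {L M}

/-- **Momentum regularity of an interpolant from coefficient moments** (any lattice data `f`): if the lattice cosine coefficients of `f` have
`j`-th moment `≤ m`, then `‖Dʲ evalM (symInterp L f)‖ ≤ m` everywhere. -/
theorem norm_iteratedFDeriv_evalM_symInterp_le_of_moments {f : TorusSite 2 L → ℝ} {j : ℕ} {m : ℝ}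
    (hm : ∑ x : TorusSite 2 L, (1 + (x 0).valMinAbs.natAbs + (x 1).valMinAbs.natAbs : ℝ) ^ j * |torusCosCoeff L f x| ≤ m)
    (q : Momentum) : ‖iteratedFDeriv ℝ j (evalM (symInterp L f)) q‖ ≤ m :=
  (norm_iteratedFDeriv_evalM_le_coeffNorm _ j q).trans ((coeffNorm_symInterp_le _ j).trans hm)

/-- **Angular derivatives of the local part from the chain rule** (function frame): if `‖Dⁱ evalM S_n‖ ≤ C` on `Momentum` for `i ≤ m` and the
Fermi-point map `γ = toLp ∘ klFermiPointFn μ K` is `C^m` with `‖Dⁱγ(θ)‖ ≤ Dⁱ` for `1 ≤ i ≤ m`, then `|∂_θ^m ν_n(K)(θ)| ≤ m!·C·D^m`. -/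
theorem abs_iteratedDeriv_klLocalPartFn_le {β U μ : ℝ} {K : FrameFn} {n m : ℕ} {C D : ℝ}
    (hC : ∀ i ≤ m, ∀ q : Momentum, ‖iteratedFDeriv ℝ i (evalM (symInterp L (klLocSelfEnergyRe L M β U μ (toTrigPoly L K) n))) q‖ ≤ C)
    (hγ : ContDiff ℝ m fun θ => (WithLp.toLp 2 (klFermiPointFn μ K θ) : Momentum))
    (hD : ∀ i, 1 ≤ i → i ≤ m → ∀ θ : ℝ,
      ‖iteratedDeriv i (fun θ => (WithLp.toLp 2 (klFermiPointFn μ K θ) : Momentum)) θ‖ ≤ D ^ i) (θ : ℝ) :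
    |iteratedDeriv m (klLocalPartFn L M β U μ K n) θ| ≤ m.factorial * C * D ^ m := by
  rw [← Real.norm_eq_abs, ← norm_iteratedFDeriv_eq_norm_iteratedDeriv, klLocalPartFn_eq_comp]
  refine norm_iteratedFDeriv_comp_le (N := (m : ℕ∞)) (contDiff_evalM _) (by exact_mod_cast hγ) le_rfl θ
    (fun i hi => hC i hi _) fun i hi1 hi2 => ?_
  rw [norm_iteratedFDeriv_eq_norm_iteratedDeriv]
  exact hD i hi1 hi2 θ

/-- **(E3g-Fn) FROM MOMENTUM REGULARITY AND THE CURVE.**  `‖Dⁱ evalM S_n‖ ≤ C` (`i ≤ 4`), `γ = toLp ∘ klFermiPointFn μ K` of class `C⁴` with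
`‖Dⁱγ‖ ≤ Dⁱ` (`1 ≤ i ≤ 4`), and the fit `j!·C·Dʲ ≤ angBar G Q R U (nScales β) j` (`1 ≤ j ≤ 4`) give `TwoLegAngularFn … K n`. -/
theorem twoLegAngularFn_of_curve_bounds {G : GeoConsts} {Q : EngConsts} {R : RenConsts} {β U μ : ℝ} {K : FrameFn} {n : ℕ}
    {C D : ℝ} (hC : ∀ i ≤ 4, ∀ q : Momentum, ‖iteratedFDeriv ℝ i (evalM (symInterp L (klLocSelfEnergyRe L M β U μ (toTrigPoly L K) n))) q‖ ≤ C)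
    (hγ : ContDiff ℝ 4 fun θ => (WithLp.toLp 2 (klFermiPointFn μ K θ) : Momentum))
    (hD : ∀ i, 1 ≤ i → i ≤ 4 → ∀ θ : ℝ,
      ‖iteratedDeriv i (fun θ => (WithLp.toLp 2 (klFermiPointFn μ K θ) : Momentum)) θ‖ ≤ D ^ i)
    (hfit : ∀ j, 1 ≤ j → j ≤ 4 → (j.factorial : ℝ) * C * D ^ j ≤ angBar G Q R U (nScales β) j) :
    TwoLegAngularFn L M G Q R β U μ K n := by
  refine ⟨?_, fun j hj1 hj4 θ => ?_⟩
  · rw [klLocalPartFn_eq_comp]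
    exact (contDiff_evalM _).comp hγ
  · have hCj : ∀ i ≤ j, ∀ q : Momentum,
        ‖iteratedFDeriv ℝ i (evalM (symInterp L (klLocSelfEnergyRe L M β U μ (toTrigPoly L K) n))) q‖ ≤ C :=
      fun i hi q => hC i (hi.trans hj4) q
    have hγj : ContDiff ℝ j fun θ => (WithLp.toLp 2 (klFermiPointFn μ K θ) : Momentum) := hγ.of_le (by exact_mod_cast hj4)
    have hDj : ∀ i, 1 ≤ i → i ≤ j → ∀ θ : ℝ,
        ‖iteratedDeriv i (fun θ => (WithLp.toLp 2 (klFermiPointFn μ K θ) : Momentum)) θ‖ ≤ D ^ i :=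
      fun i hi1 hi2 θ => hD i hi1 (hi2.trans hj4) θ
    exact (abs_iteratedDeriv_klLocalPartFn_le hCj hγj hDj θ).trans (hfit j hj1 hj4)

/-- **(E3g-Fn) FROM MOMENTS AND THE CURVE**: moments of orders `≤ 4` of the scale-`n` two-leg coefficients (data at the model's frame
`toTrigPoly L K`) bounded by `m`, a `C⁴` Fermi-point map with `‖Dⁱγ‖ ≤ Dⁱ` (`1 ≤ i ≤ 4`), and the fit `j!·m·Dʲ ≤ angBar … j` (`1 ≤ j ≤ 4`) give
`TwoLegAngularFn … K n` — the engine's (E3g) duty is the MOMENT bound, the rest is the frame geometry. [cite: BenfattoGiulianiMastropietro2006, (2.36)] -/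
theorem twoLegAngularFn_of_moments_and_curve {G : GeoConsts} {Q : EngConsts} {R : RenConsts} {β U μ : ℝ} {K : FrameFn} {n : ℕ}
    {m D : ℝ}
    (hm : ∀ j ≤ 4, ∑ x : TorusSite 2 L, (1 + (x 0).valMinAbs.natAbs + (x 1).valMinAbs.natAbs : ℝ) ^ j *
      |torusCosCoeff L (klLocSelfEnergyRe L M β U μ (toTrigPoly L K) n) x| ≤ m)
    (hγ : ContDiff ℝ 4 fun θ => (WithLp.toLp 2 (klFermiPointFn μ K θ) : Momentum))
    (hD : ∀ i, 1 ≤ i → i ≤ 4 → ∀ θ : ℝ,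
      ‖iteratedDeriv i (fun θ => (WithLp.toLp 2 (klFermiPointFn μ K θ) : Momentum)) θ‖ ≤ D ^ i)
    (hfit : ∀ j, 1 ≤ j → j ≤ 4 → (j.factorial : ℝ) * m * D ^ j ≤ angBar G Q R U (nScales β) j) :
    TwoLegAngularFn L M G Q R β U μ K n :=
  twoLegAngularFn_of_curve_bounds (fun i hi q => norm_iteratedFDeriv_evalM_symInterp_le_of_moments (hm i hi) q) hγ hD hfit

end Model

end Summit.HubbardSuperconductivity.HubbardSuperconductivity.Theorems.KLRegimeSplit

end
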